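import Summits.QuantumFields.YangMills.Theorems.ParabolicTrajectoryContinuumLimitOnTrajectorySlabRP

/-!
# Route `OneCertifiedCube`, crux `ContinuumLimitExists` (stmt-QuantumFields-16124), line `birth`: stub `stub_oddTorusRP`

Registered stub 3 of the birth skeleton `Cruxes/ContinuumLimitExists/Lines/birth.lean` (lead
`prover-line-stmt-QuantumFields-16124-0`): reflection positivity of slab observables on the scheme's ODD tori
`2L_k+1` for the site reflection `t ↦ −t` (`GaugeConfig.negReflect`), eventually in `k`, from `0 ≤ β_k` eventually
(`TorusSlabRP r sch`, vocabulary of the sibling crux `ContinuumLimitOnTrajectory`, `…DefsC` §6).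

The statement is, binder for binder, the landed sibling theorem
`TwoOrbitSynchronisation.torusSlabRP_of_eventually_nonneg` (`…ContinuumLimitOnTrajectorySlabRP.lean`, p124885:
Osterwalder–Seiler mixed site/link positivity on the odd torus in `negReflect` coordinates,
`WilsonOddRPNegCoords.wilsonExpectation_nonneg_of_negCovariant`, transported to the slab edge sets `1 ≤ t ≤ w`,
`2w ≤ L_k`), with the group binder explicit; this file only re-exports it under the registered name so that the
skeleton's composition `ContinuumLimitExists_of` cites the stub BY NAME.
Refs: OsterwalderSeiler1978 §2; Seiler1982 Ch. 2 (via the tree theorem).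
-/

set_option autoImplicit false

namespace Summit.QuantumFields.YangMills.Cruxes.ContinuumLimitExists.Birth

open Filter
open Literature.MathematicalPhysics.QuantumFieldTheory
open Summit.QuantumFields.YangMills.Cruxes.ContinuumLimitOnTrajectory.TwoOrbitSynchronisation

/-- **Stub 3 `stub_oddTorusRP` of line `birth` (crux stmt-QuantumFields-16124) — reflection positivity of slab
observables on the scheme's odd tori.** If `0 ≤ β_k` eventually, then eventually in `k` Wilson's measure on the
torus of side `2L_k+1` is reflection positive for the site reflection `t ↦ −t` (`GaugeConfig.negReflect`) on bounded
measurable observables of the links based at times `1, …, w`, `2w ≤ L_k` (`TorusSlabRP r sch`). Proof: the landed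
sibling theorem `torusSlabRP_of_eventually_nonneg` (Osterwalder–Seiler 1978 §2 on odd tori, tree
`wilsonExpectation_nonneg_of_negCovariant`, conjugated to the slab edge sets). -/
theorem stub_oddTorusRP :
    ∀ (G : Type) [Group G] [TopologicalSpace G] [IsTopologicalGroup G] [CompactSpace G]
      [MeasurableSpace G] [BorelSpace G] (r : LatticeRep G) (sch : SpeciesScheme (YMSpecies G)),
      (∀ᶠ k in Filter.atTop, 0 ≤ sch.β k) → TorusSlabRP r sch :=
  fun _G _ _ _ _ _ _ r sch hβ => torusSlabRP_of_eventually_nonneg r sch hβ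

end Summit.QuantumFields.YangMills.Cruxes.ContinuumLimitExists.Birth
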